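import Summits.RiemannHypothesis.RiemannHypothesis.Theorems.PfPersistenceCentralMassFloor
import HarnessLib

/-!
# PF persistence — the FLOOR BINDER `φ` of the nodelessness readers, typed by name (RULING A88 ADDENDUM 2 (δ))
(pub-rhpf barrier-typer gen 5; lead g9 overdue-stamp ask 14:13:46Z; rows C4-I6 / G1.01 (eo) / regime II)

**HONEST FRAMING. This is a long-odds MECHANISM SEARCH; no RH claims.** Statements and elementary lemmas only.
RULING A88 add. 2 (δ): every row that says "nodeless / one-signed profile" must carry the FLOOR `φ` as an explicit
binder, because the loader's reading of record is "no sign change of `θ` once the values with `|θ| ≤ φ·max|θ|` are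
zeroed" (`rp-panel.json` profile rule, `φ = 1e-20`), and at `φ = 0` (the RAW reading, the tree's `OneSigned` /
`oneSignedAt`) the reader rejects `ζ` itself at the served window `(1.96, 600)` (odd raw count 13, DATA).  This file
types the floored reader on the cell's `Datum` (even block; the odd block takes the same definitions verbatim):

* `profileMax L u = sup_{[-L/2, L/2]} |θ_u|`; `FloorOneSigned L φ u` — the `φ`-floored one-signedness
  `(∀ x, θ_u(x) ≥ −φ·max|θ_u|) ∨ (∀ x, θ_u(x) ≤ φ·max|θ_u|)`; `floorNodelessAt φ win` — "the bottom vector of `d(win)` is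
  `φ`-floor nodeless" (the binder the rows must name: `FloorNodelessAt φ` of A88 add. 2).
* `floorOneSigned_zero_iff` (`φ = 0` is the RAW reader `OneSigned`), `FloorOneSigned.mono` (monotone in `φ`),
  `OneSigned.floorOneSigned` (raw ⇒ floored for `φ ≥ 0`), `floorOneSigned_of_one_le` (`φ ≥ 1` is vacuous) — so `φ`
  is a genuine 𝒞-PRIMITIVE interpolating between the raw reader and the trivial one;
  `floorNodelessAt_zero`, `oneSignedAt_subset_floorNodelessAt`, `floorNodelessAt_mono`.
* `finitelyDetermined_floorNodelessAt` — a single-window reader: inside the locality barrier's scope (W1) for every `φ`.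
-/

set_option linter.dupNamespace false

noncomputable section

open Real Set Matrix

namespace Summit.RiemannHypothesis.RiemannHypothesis.Theorems.PfPersistence

/-- `max_{[-L/2, L/2]} |θ_u|` (as a supremum of the image; `0` on an empty window). -/
def profileMax (L : ℝ) {N : ℕ} (u : Fin (N + 1) → ℝ) : ℝ :=
  sSup ((fun x => |profile L u x|) '' Icc (-(L / 2)) (L / 2))

/-- PROVED: `|θ_u(x)| ≤ profileMax` on the window. [folklore] -/
theorem abs_profile_le_profileMax (L : ℝ) {N : ℕ} (u : Fin (N + 1) → ℝ) {x : ℝ}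
    (hx : x ∈ Icc (-(L / 2)) (L / 2)) : |profile L u x| ≤ profileMax L u := by
  have hc : Continuous fun x => |profile L u x| := (CentralMassFloor.continuous_profile L u).abs
  exact le_csSup (isCompact_Icc.image_of_continuousOn hc.continuousOn).bddAbove (mem_image_of_mem _ hx)

/-- PROVED: `0 ≤ profileMax`. [folklore] -/
theorem profileMax_nonneg (L : ℝ) {N : ℕ} (u : Fin (N + 1) → ℝ) : 0 ≤ profileMax L u := by
  by_cases h : (Icc (-(L / 2)) (L / 2)).Nonempty
  · obtain ⟨x, hx⟩ := h
    exact (abs_nonneg _).trans (abs_profile_le_profileMax L u hx)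
  · rw [not_nonempty_iff_eq_empty] at h
    simp [profileMax, h]

/-- **TYPED — THE `φ`-FLOORED ONE-SIGNEDNESS** (the loader's reading: no sign change of `θ_u` once the values with
`|θ_u| ≤ φ·max|θ_u|` are zeroed): not both a value above `φ·max|θ_u|` and a value below `−φ·max|θ_u|`. -/
def FloorOneSigned (L φ : ℝ) {N : ℕ} (u : Fin (N + 1) → ℝ) : Prop :=
  (∀ x ∈ Icc (-(L / 2)) (L / 2), -(φ * profileMax L u) ≤ profile L u x) ∨
    (∀ x ∈ Icc (-(L / 2)) (L / 2), profile L u x ≤ φ * profileMax L u)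

/-- PROVED: at `φ = 0` the floored reader IS the raw reader `OneSigned`. [folklore] -/
theorem floorOneSigned_zero_iff (L : ℝ) {N : ℕ} (u : Fin (N + 1) → ℝ) : FloorOneSigned L 0 u ↔ OneSigned L u := by
  simp [FloorOneSigned, OneSigned]

/-- PROVED: the floored reader is MONOTONE in the floor. [folklore] -/
theorem FloorOneSigned.mono {L φ φ' : ℝ} {N : ℕ} {u : Fin (N + 1) → ℝ} (h : FloorOneSigned L φ u) (hle : φ ≤ φ') :
    FloorOneSigned L φ' u := by
  have hM := profileMax_nonneg L u
  have hφ : φ * profileMax L u ≤ φ' * profileMax L u := mul_le_mul_of_nonneg_right hle hM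
  rcases h with h | h
  · exact Or.inl fun x hx => by linarith [h x hx]
  · exact Or.inr fun x hx => (h x hx).trans hφ

/-- PROVED: raw one-signed ⇒ `φ`-floor one-signed for every `φ ≥ 0`. [folklore] -/
theorem OneSigned.floorOneSigned {L φ : ℝ} {N : ℕ} {u : Fin (N + 1) → ℝ} (h : OneSigned L u) (hφ : 0 ≤ φ) :
    FloorOneSigned L φ u :=
  ((floorOneSigned_zero_iff L u).2 h).mono hφ

/-- PROVED: at `φ ≥ 1` the floored reader is VACUOUS (everything is floored) — so `φ` interpolates between the raw
reader (`φ = 0`) and the trivial one. [folklore] -/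
theorem floorOneSigned_of_one_le {L φ : ℝ} {N : ℕ} (u : Fin (N + 1) → ℝ) (hφ : 1 ≤ φ) : FloorOneSigned L φ u := by
  refine Or.inr fun x hx => ?_
  have h1 := abs_profile_le_profileMax L u hx
  have hM := profileMax_nonneg L u
  calc profile L u x ≤ |profile L u x| := le_abs_self _
    _ ≤ 1 * profileMax L u := by rw [one_mul]; exact h1
    _ ≤ φ * profileMax L u := mul_le_mul_of_nonneg_right hφ hM

/-- **TYPED — `FloorNodelessAt φ`** (the binder of A88 add. 2 (δ)): the single-window criterion "some bottom vector of
`d(win)` has a `φ`-floor one-signed profile". -/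
def floorNodelessAt (φ : ℝ) (win : Window) : Set Datum :=
  {d | ∃ u, IsBottomVector (d win) u ∧ FloorOneSigned (2 * win.a) φ u}

/-- PROVED: `floorNodelessAt 0 = oneSignedAt` (the raw reader of the tree). [folklore] -/
theorem floorNodelessAt_zero (win : Window) : floorNodelessAt 0 win = oneSignedAt win := by
  ext d
  simp only [floorNodelessAt, oneSignedAt, mem_setOf_eq, floorOneSigned_zero_iff]

/-- PROVED: the raw reader implies every floored reader (`φ ≥ 0`). [folklore] -/
theorem oneSignedAt_subset_floorNodelessAt {φ : ℝ} (hφ : 0 ≤ φ) (win : Window) :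
    oneSignedAt win ⊆ floorNodelessAt φ win := by
  rintro d ⟨u, hu, h⟩
  exact ⟨u, hu, h.floorOneSigned hφ⟩

/-- PROVED: monotone in the floor. [folklore] -/
theorem floorNodelessAt_mono {φ φ' : ℝ} (hle : φ ≤ φ') (win : Window) :
    floorNodelessAt φ win ⊆ floorNodelessAt φ' win := by
  rintro d ⟨u, hu, h⟩
  exact ⟨u, hu, h.mono hle⟩

/-- PROVED: a single-window reader — FINITELY DETERMINED for every floor, hence inside the scope of the locality
barrier W1 (`finitelyDetermined_of_window`). [folklore] -/
theorem finitelyDetermined_floorNodelessAt (φ : ℝ) (win : Window) : FinitelyDetermined (floorNodelessAt φ win) :=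
  finitelyDetermined_of_window win fun M => ∃ u, IsBottomVector M u ∧ FloorOneSigned (2 * win.a) φ u

end Summit.RiemannHypothesis.RiemannHypothesis.Theorems.PfPersistence

end
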